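import Summits.CriticalPhenomena.CardyFormulaZ2.Theorems.CardyComplexConeEdgePrecompactResponseLocalisation
import Literature.Probability.Percolation.PlanarDuality
import Literature.Probability.Percolation.FourArmGarbanRevealment
import Literature.Probability.LatticeModels.InnerFacesHoleFree

/-!
# The strands of a SPLIT discrepancy and the arms they carry
(line `qkz-strip-boundary-arm` of crux `CardyComplexCone.EdgePrecompact`, stmt-CriticalPhenomena-11387;
deterministic combinatorics of items 3–4 of the road map for the uniform forward response stability
"UFRS", module docstring of `Theorems/CardyComplexConeEdgePrecompactUniformForwardResponseStability.lean`)

Setting of `responseLocalisation` (`…EdgePrecompactResponseLocalisation.lean`): two configurations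
`β₀, β₁`, inner-face predicates `In₀, In₁`, the set `I` of medial vertices of the ball, orbits
`Oᵢ = cornerOrbit βᵢ` of Smirnov's successor map. A forward-response failure of the pair `(c₀, c₁)`
sits at a re-entry time `n` of the `β₀`-orbit of `c₀` and, unless INITIAL, at a last synchronised
corner `e = O₀ c₀ m = O₁ c₁ k` followed by a FACE or a SPLIT discrepancy. This file supplies the
purely combinatorial facts about the medial STRANDS through the medial vertex `cTgt e` which the
arm estimates of items 3–5 consume; no planarity and no probability enter.

* `cornerOrbit_injOn_stretch`: a stretch (targets off `I` before `n`, target in `I` at `n`) visits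
  pairwise distinct corners — the incoming whisker `W₀ = O₀ c₀ [0, m]` and the outgoing run
  `R₀ = O₀ c₀ (m, n]` are dart-disjoint and simple.
* `exists_runEnd` (**no idle cycling**, registered sub-goal): if the corners with `In₁`-inner face
  are finitely many and `c₁` cannot be reached by a good step (`nextCorner β₁ p ≠ c₁` whenever
  `cFace p` is inner and `cTgt p ∉ I` — true for a start corner, whose predecessors have non-inner
  faces, and for an exit corner of the ball, whose predecessors have their target in `I`), then the
  `β₁`-orbit of any corner `e = O₁ c₁ k` reached through a good stretch has a RUN END `T`: a good
  stretch `O₁ e [0, T]` followed by an entry into `I` (`cTgt (O₁ e T) ∈ I`) or an exit from the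
  inner faces (`¬ In₁ (cFace (O₁ e (T+1)))`). This is the run `R₁` of item 3.
* `split_firstReturn_or_none` / `splitStrands` (registered sub-goal): the dichotomy (A)/(B) of
  items 3–4 — either the run `R₁ = O₁ e (0, T]` shares no corner with `R₀` (case (A): together with
  `W₀` three pairwise dart-disjoint strands at `cTgt e`, `R₀` ending in the ball, `R₁` ending in the
  ball or at the exit edge of the second datum), or it FIRST returns to `R₀` at `O₁ e j = O₀ c₀ j₀`,
  and then (SPLIT clause of `responseLocalisation`) with a turning mismatch
  `∑_{i<j} turnOf β₁ (O₁ e i) ≠ ∑_{m ≤ i < j₀} turnOf β₀ (O₀ c₀ i)`, the two runs `O₀ c₀ [m, j₀]`,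
  `O₁ e [0, j]` meeting only at their ends (case (B), the bigon of item 4).
* `exists_leftWalk` / `exists_rightWalk` (registered sub-goal `exists_orbitArms`): **what a strand
  keeps on its two sides**, in the walk vocabulary of the tree's arm events (`zdDomArmEvent`,
  `Z2HalfPlane.threeArm`): along any stretch `O c [i, j]` of any orbit, the left vertices are joined
  by a lattice walk whose edges are target edges FOLLOWED by the stretch (open: `∈ β`), and the right
  faces by a walk of the dual lattice whose steps cross target edges CROSSED by the stretch (closed:
  `∉ β`; the crossed primal edge of a dual step `z → z'` is the tree's `sepEdge z z'`,
  `sepEdge_faceAt_succ`). Supports stay among the vertices (faces) of the stretch, hence within one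
  mesh of its medial polyline.

References: S. Smirnov, C. R. Acad. Sci. Paris 333 (2001), §2 (the exploration process: open edges on
its left, dual-open edges on its right); G. Grimmett, *Percolation* (1999), §11.2 (planar duality on
`ℤ²`); P. Nolin, Electron. J. Probab. 13 (2008), §4 (arm events).
-/

namespace Summit.CriticalPhenomena.CardyFormulaZ2.Cruxes.EdgePrecompact.QkzStripBoundaryArm

open MeasureTheory Filter Set Metric
open scoped Topology BigOperators Pointwise
open Literature.Probability.LatticeModels Literature.Probability.Percolation
open Literature.Probability.RandomPlanarGeometry (DobrushinDomain)
open Summit.CriticalPhenomena.CardyFormulaZ2.Theses.CardyComplexCone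

noncomputable section

/-! ## Orbit bookkeeping: iterated injectivity, simple stretches -/

/-- Iterated injectivity of the successor map: equal corners at times `a + t`, `b + t` were equal
at times `a`, `b`. -/
theorem cornerOrbit_add_right_cancel (β : BondConfig (Site 2)) (c : Site 2 × Fin 4) {a b : ℕ}
    (t : ℕ) (h : cornerOrbit β c (a + t) = cornerOrbit β c (b + t)) :
    cornerOrbit β c a = cornerOrbit β c b := by
  induction t with
  | zero => simpa using h
  | succ t ih =>
    have h' : nextCorner β (cornerOrbit β c (a + t)) = nextCorner β (cornerOrbit β c (b + t)) := h
    exact ih (nextCorner_injective h')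

/-- **A stretch is simple.** If the targets of `O c 0, …, O c (n-1)` lie off `I` and the target of
`O c n` lies in `I`, the corners `O c 0, …, O c n` are pairwise distinct (a repetition would make
the orbit periodic and put an earlier target in `I`). In particular the incoming whisker
`O c [0, m]` and the outgoing run `O c (m, n]` of a localised failure share no corner. -/
theorem cornerOrbit_injOn_stretch {β : BondConfig (Site 2)} {I : Set (Sym2 (Site 2))}
    {c : Site 2 × Fin 4} {n : ℕ} (hpre : ∀ i < n, cTgt (cornerOrbit β c i) ∉ I)
    (hin : cTgt (cornerOrbit β c n) ∈ I) {i j : ℕ} (hi : i ≤ n) (hj : j ≤ n)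
    (h : cornerOrbit β c i = cornerOrbit β c j) : i = j := by
  by_contra hne
  wlog hij : i < j generalizing i j
  · exact this hj hi h.symm (Ne.symm hne) (lt_of_le_of_ne (not_lt.1 hij) (Ne.symm hne))
  have key : cornerOrbit β c (i + (n - j)) = cornerOrbit β c n := by
    rw [cornerOrbit_add_eq, h, ← cornerOrbit_add_eq, Nat.add_sub_cancel' hj]
  exact hpre (i + (n - j)) (by omega) (by rw [key]; exact hin)

/-- A repetition makes the orbit periodic from the first occurrence on. -/
theorem cornerOrbit_periodic {β : BondConfig (Site 2)} {c : Site 2 × Fin 4} {i j : ℕ}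
    (h : cornerOrbit β c i = cornerOrbit β c j) (t : ℕ) :
    cornerOrbit β c (i + t) = cornerOrbit β c (j + t) := by
  rw [cornerOrbit_add_eq, h, ← cornerOrbit_add_eq]

/-- **A run is simple.** A good stretch `O c [0, T]` (targets off `I` before `T`, faces `1 … T`
inner) which ENDS at `T` — by entering `I` or by leaving the inner faces at the next step — visits
pairwise distinct corners. -/
theorem cornerOrbit_injOn_run {β : BondConfig (Site 2)} {In : Site 2 → Prop} {I : Set (Sym2 (Site 2))}
    {c : Site 2 × Fin 4} {T : ℕ}
    (hrun : ∀ i < T, cTgt (cornerOrbit β c i) ∉ I ∧ In (cFace (cornerOrbit β c (i + 1))))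
    (hend : cTgt (cornerOrbit β c T) ∈ I ∨ ¬ In (cFace (cornerOrbit β c (T + 1))))
    {i j : ℕ} (hi : i ≤ T) (hj : j ≤ T) (h : cornerOrbit β c i = cornerOrbit β c j) : i = j := by
  rcases hend with hin | hout
  · exact cornerOrbit_injOn_stretch (fun i hi => (hrun i hi).1) hin hi hj h
  · by_contra hne
    wlog hij : i < j generalizing i j
    · exact this hj hi h.symm (Ne.symm hne) (lt_of_le_of_ne (not_lt.1 hij) (Ne.symm hne))
    have key : cornerOrbit β c (i + (T + 1 - j)) = cornerOrbit β c (T + 1) := by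
      rw [cornerOrbit_periodic h, show j + (T + 1 - j) = T + 1 by omega]
    obtain ⟨s, hs⟩ : ∃ s, i + (T + 1 - j) = s + 1 := ⟨i + (T - j), by omega⟩
    rw [hs] at key
    exact hout (key ▸ (hrun s (by omega)).2)

/-! ## No idle cycling: the run of the second dynamics ends -/

/-- **No idle cycling** (registered sub-goal `exists_runEnd` of stmt-CriticalPhenomena-11387; the run
`R₁` of item 3 of the UFRS road map is finite). Data: a configuration `β`, an inner-face predicate
`In`, the set `I`, a corner `c₁` and a good stretch `O c₁ [0, k]` (targets off `I`, faces inner).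
HYPOTHESES: the corners with inner face form a finite set; `c₁` is not reached by a good step
(`nextCorner β p ≠ c₁` whenever `cFace p` is inner and `cTgt p ∉ I`); the face of `c₁` is inner.
CONCLUSION: the orbit of `e = O c₁ k` has a run end `T` — a good stretch `O e [0, T]` with
`cTgt (O e T) ∈ I` (entry into the ball) or `¬ In (cFace (O e (T + 1)))` (exit from the inner
faces). Proof: otherwise the whole orbit of `c₁` is good, lives in the finite set of inner corners,
repeats, and by injectivity of the successor map returns to `c₁` itself by a good step. -/
theorem exists_runEnd : ∀ (β : BondConfig (Site 2)) (In : Site 2 → Prop) (I : Set (Sym2 (Site 2))) (c₁ : Site 2 × Fin 4) (k : ℕ), {p : Site 2 × Fin 4 | In (cFace p)}.Finite → (∀ p : Site 2 × Fin 4, In (cFace p) → cTgt p ∉ I → nextCorner β p ≠ c₁) → In (cFace c₁) → (∀ i < k, cTgt (cornerOrbit β c₁ i) ∉ I ∧ In (cFace (cornerOrbit β c₁ (i + 1)))) → ∃ T : ℕ, (∀ i < T, cTgt (cornerOrbit β (cornerOrbit β c₁ k) i) ∉ I ∧ In (cFace (cornerOrbit β (cornerOrbit β c₁ k) (i + 1))))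 ∧ (cTgt (cornerOrbit β (cornerOrbit β c₁ k) T) ∈ I ∨ ¬ In (cFace (cornerOrbit β (cornerOrbit β c₁ k) (T + 1)))) := by
  intro β In I c₁ k hfin hidle hIn hStr
  by_contra hcon
  push Not at hcon
  -- every run length is good
  have hall' : ∀ T, ∀ i < T, cTgt (cornerOrbit β (cornerOrbit β c₁ k) i) ∉ I ∧
      In (cFace (cornerOrbit β (cornerOrbit β c₁ k) (i + 1))) := by
    intro T
    induction T with
    | zero => intro i hi; exact absurd hi (Nat.not_lt_zero i)
    | succ T ih =>
      intro i hi
      rcases Nat.lt_succ_iff_lt_or_eq.1 hi with hi | rfl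
      · exact ih i hi
      · exact hcon i ih
  -- hence every step of the orbit of `c₁` is good
  have hall : ∀ j, cTgt (cornerOrbit β c₁ j) ∉ I ∧ In (cFace (cornerOrbit β c₁ (j + 1))) := by
    intro j
    rcases Nat.lt_or_ge j k with hj | hj
    · exact hStr j hj
    · obtain ⟨i, rfl⟩ : ∃ i, j = k + i := ⟨j - k, by omega⟩
      have := hall' (i + 1) i (Nat.lt_succ_self i)
      rwa [← cornerOrbit_add_eq, ← cornerOrbit_add_eq, ← add_assoc] at this
  have hmem : ∀ j, cornerOrbit β c₁ j ∈ {p : Site 2 × Fin 4 | In (cFace p)} := by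
    intro j
    rcases j with _ | j
    · exact hIn
    · exact (hall j).2
  -- the orbit repeats, hence returns to `c₁` by a good step
  obtain ⟨i, j, hij, hEq⟩ := hfin.exists_lt_map_eq_of_forall_mem hmem
  obtain ⟨d, rfl⟩ : ∃ d, j = d + 1 + i := ⟨j - i - 1, by omega⟩
  have h0 : cornerOrbit β c₁ 0 = cornerOrbit β c₁ (d + 1) :=
    cornerOrbit_add_right_cancel β c₁ i (by rwa [zero_add])
  have hstep : nextCorner β (cornerOrbit β c₁ d) = c₁ := h0.symm
  exact hidle _ (hmem d) (hall d).1 hstep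

/-! ## The dichotomy (A)/(B): no return, or a first return -/

/-- **First return or none.** For the run `O₁ e (0, T]` of the second dynamics and the run
`O₀ c₀ (m, n]` of the first: either they share no corner, or there is a FIRST time `j ∈ [1, T]` at
which `O₁ e j` is a corner `O₀ c₀ j₀`, `m < j₀ ≤ n`, no earlier time `j' ∈ [1, j)` doing so. -/
theorem split_firstReturn_or_none (β₀ β₁ : BondConfig (Site 2)) (c₀ e : Site 2 × Fin 4) (m n T : ℕ) :
    (∀ j, 1 ≤ j → j ≤ T → ∀ j₀, m < j₀ → j₀ ≤ n → cornerOrbit β₁ e j ≠ cornerOrbit β₀ c₀ j₀) ∨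
    (∃ j j₀, 1 ≤ j ∧ j ≤ T ∧ m < j₀ ∧ j₀ ≤ n ∧ cornerOrbit β₁ e j = cornerOrbit β₀ c₀ j₀ ∧
      ∀ j', 1 ≤ j' → j' < j → ∀ j₀', m < j₀' → j₀' ≤ n →
        cornerOrbit β₁ e j' ≠ cornerOrbit β₀ c₀ j₀') := by
  classical
  by_cases h : ∃ j, (1 ≤ j ∧ j ≤ T) ∧ ∃ j₀, m < j₀ ∧ j₀ ≤ n ∧ cornerOrbit β₁ e j = cornerOrbit β₀ c₀ j₀
  · right
    obtain ⟨⟨h1, hT⟩, j₀, hm, hn, hEq⟩ := Nat.find_spec h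
    have hmin : ∀ j' < Nat.find h, ¬ ((1 ≤ j' ∧ j' ≤ T) ∧
        ∃ j₀, m < j₀ ∧ j₀ ≤ n ∧ cornerOrbit β₁ e j' = cornerOrbit β₀ c₀ j₀) :=
      fun j' hj' => Nat.find_min h hj'
    refine ⟨Nat.find h, j₀, h1, hT, hm, hn, hEq, fun j' h1' hj' j₀' hm' hn' hEq' =>
      hmin j' hj' ⟨⟨h1', ?_⟩, j₀', hm', hn', hEq'⟩⟩
    exact le_trans hj'.le hT
  · left
    intro j h1 hT j₀ hm hn hEq
    exact h ⟨j, ⟨h1, hT⟩, j₀, hm, hn, hEq⟩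

/-- **The strands of a SPLIT discrepancy** (registered sub-goal `splitStrands` of
stmt-CriticalPhenomena-11387; items 3–4 of the UFRS road map, combinatorial part). Data: the
`β₀`-stretch of `c₀` re-entering `I` at time `n`, a synchronised index `m < n` with corner
`e = O₀ c₀ m`, the SPLIT clause of `responseLocalisation` at `e` (every good return of the
`β₁`-orbit of `e` to `O₀ c₀ (m, n]` carries a turning mismatch) and a run end `T` of the `β₁`-orbit
of `e` (`exists_runEnd`). CONCLUSION: the whisker-and-run `O₀ c₀ [0, n]` and the run `O₁ e [0, T]`
are simple, the two runs leave `cTgt e` by different out-darts and opposite turns, and EITHER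
(A) the run `O₁ e (0, T]` shares no corner with the run `O₀ c₀ (m, n]` — three strands at the medial
vertex `cTgt e`: the whisker `O₀ c₀ [0, m]` from the ball, the run `O₀ c₀ (m, n]` to the ball, the
run `O₁ e (0, T]` to the ball or to the exit edge, the last two leaving `cTgt e` by different turns —
OR (B) the run `O₁ e (0, T]` first returns to `O₀ c₀ (m, n]` at `O₁ e j = O₀ c₀ j₀` with a turning
mismatch, its earlier corners `O₁ e [1, j)` avoiding `O₀ c₀ (m, n]` (a bigon from `cTgt e` to
`cSrc (O₀ c₀ j₀)`). -/
theorem splitStrands : ∀ (β₀ β₁ : BondConfig (Site 2)) (In₀ In₁ : Site 2 → Prop) (I : Set (Sym2 (Site 2))) (c₀ : Site 2 × Fin 4) (m n T : ℕ), m < n → (∀ i < n, cTgt (cornerOrbit β₀ c₀ i) ∉ I ∧ In₀ (cFace (cornerOrbit β₀ c₀ (i + 1)))) → cTgt (cornerOrbit β₀ c₀ n) ∈ I → ¬ (cTgt (cornerOrbit β₀ c₀ m) ∈ β₀ ↔ cTgt (cornerOrbit β₀ c₀ m) ∈ β₁) → (∀ j j₀ : ℕ, m < j₀ → j₀ ≤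 n → (∀ i < j, cTgt (cornerOrbit β₁ (cornerOrbit β₀ c₀ m) i) ∉ I ∧ In₁ (cFace (cornerOrbit β₁ (cornerOrbit β₀ c₀ m) (i + 1)))) → cornerOrbit β₁ (cornerOrbit β₀ c₀ m) j = cornerOrbit β₀ c₀ j₀ → ∑ i ∈ Finset.range j, turnOf β₁ (cornerOrbit β₁ (cornerOrbit β₀ c₀ m) i) ≠ ∑ i ∈ Finset.Ico m j₀, turnOf β₀ (cornerOrbit β₀ c₀ i)) → (∀ i < T, cTgt (cornerOrbit β₁ (cornerOrbit β₀ c₀ m) i) ∉ I ∧ In₁ (cFace (cornerOrbit β₁ (cornerOrbit β₀ c₀ m) (i + 1)))) → (cTgt (cornerOrbit β₁ (cornerOrbit β₀ c₀ m) T) ∈ I ∨ ¬ In₁ (cFace (cornerOrbit β₁ (cornerOrbit β₀ c₀ m) (T + 1)))) → (∀ i j : ℕ, i ≤ n → j ≤ n → cornerOrbit β₀ c₀ i = cornerOrbit β₀ c₀ j → i = j) ∧ (∀ i j : ℕ, i ≤ T → j ≤ T → cornerOrbit β₁ (cornerOrbit β₀ c₀ m) i = cornerOrbit β₁ (cornerOrbit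 β₀ c₀ m) j → i = j) ∧ cornerOrbit β₁ (cornerOrbit β₀ c₀ m) 1 ≠ cornerOrbit β₀ c₀ (m + 1) ∧ turnOf β₁ (cornerOrbit β₀ c₀ m) ≠ turnOf β₀ (cornerOrbit β₀ c₀ m) ∧ ((∀ j, 1 ≤ j → j ≤ T → ∀ j₀, m < j₀ → j₀ ≤ n → cornerOrbit β₁ (cornerOrbit β₀ c₀ m) j ≠ cornerOrbit β₀ c₀ j₀) ∨ (∃ j j₀ : ℕ, 1 ≤ j ∧ j ≤ T ∧ m < j₀ ∧ j₀ ≤ n ∧ cornerOrbit β₁ (cornerOrbit β₀ c₀ m) j = cornerOrbit β₀ c₀ j₀ ∧ ∑ i ∈ Finset.range j, turnOf β₁ (cornerOrbit β₁ (cornerOrbit β₀ c₀ m) i) ≠ ∑ i ∈ Finset.Ico m j₀, turnOf β₀ (cornerOrbit β₀ c₀ i) ∧ ∀ j', 1 ≤ j' → j' < j → ∀ j₀', m < j₀' → j₀' ≤ n → cornerOrbit β₁ (cornerOrbit β₀ c₀ m) j' ≠ cornerOrbit β₀ c₀ j₀')) := by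
  intro β₀ β₁ In₀ In₁ I c₀ m n T hmn hStr hin hmis hsplit hrun hend
  refine ⟨fun i j hi hj h => cornerOrbit_injOn_stretch (fun i hi => (hStr i hi).1) hin hi hj h,
    fun i j hi hj h => cornerOrbit_injOn_run hrun hend hi hj h, ?_, ?_, ?_⟩
  · -- the two runs leave `cTgt e` by different out-darts
    intro h
    have h' : nextCorner β₁ (cornerOrbit β₀ c₀ m) = nextCorner β₀ (cornerOrbit β₀ c₀ m) := h
    apply hmis
    by_cases h₀ : cTgt (cornerOrbit β₀ c₀ m) ∈ β₀
    · refine ⟨fun _ => ?_, fun _ => h₀⟩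
      by_contra h₁
      rw [nextCorner_of_mem h₀, nextCorner_of_not_mem h₁, Prod.mk.injEq] at h'
      exact absurd h'.2 (by simp)
    · refine ⟨fun h => absurd h h₀, fun h₁ => ?_⟩
      exfalso
      rw [nextCorner_of_not_mem h₀, nextCorner_of_mem h₁, Prod.mk.injEq] at h'
      exact absurd h'.2.symm (by simp)
  · -- and by opposite turns
    intro h
    apply hmis
    simp only [turnOf] at h
    by_cases h₀ : cTgt (cornerOrbit β₀ c₀ m) ∈ β₀
    · by_cases h₁ : cTgt (cornerOrbit β₀ c₀ m) ∈ β₁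
      · exact ⟨fun _ => h₁, fun _ => h₀⟩
      · rw [if_pos h₀, if_neg h₁] at h
        linarith [Real.pi_pos]
    · by_cases h₁ : cTgt (cornerOrbit β₀ c₀ m) ∈ β₁
      · rw [if_neg h₀, if_pos h₁] at h
        linarith [Real.pi_pos]
      · exact ⟨fun h => absurd h h₀, fun h => absurd h h₁⟩
  · rcases split_firstReturn_or_none β₀ β₁ c₀ (cornerOrbit β₀ c₀ m) m n T with hA | hB
    · exact Or.inl hA
    · obtain ⟨j, j₀, h1, hT, hm, hn, hEq, hfirst⟩ := hB
      exact Or.inr ⟨j, j₀, h1, hT, hm, hn, hEq,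
        hsplit j j₀ hm hn (fun i hi => hrun i (lt_of_lt_of_le hi hT)) hEq, hfirst⟩

/-! ## What a strand keeps on its two sides: the arms -/

/-- The face of a coded corner and the next face around its vertex are adjacent vertices of the
dual lattice (faces indexed by lower-left corners; the tree's `faceAt_succ_eq`). -/
theorem adj_cFace_faceAt_succ (p : Site 2 × Fin 4) : (zdGraph 2).Adj (cFace p) (faceAt p.1 (p.2 + 1)) := by
  rw [Literature.Probability.LatticeModels.faceAt_succ_eq]
  exact (SimpleGraph.mem_edgeSet _).1 (cSrc_mem_edgeSet (faceAt p.1 p.2, p.2 + 2))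

/-- **The primal edge crossed by a right turn**: the tree's `sepEdge` of the dual step from the face
of the corner `(x, k)` to the next face around `x` is the target edge `cTgt (x, k)` (by injectivity
of `dualEdge`, with the tree's `dualEdge_sepEdge` and `dualEdge_cTgt`). -/
theorem sepEdge_faceAt_succ (p : Site 2 × Fin 4) : sepEdge (cFace p) (faceAt p.1 (p.2 + 1)) = cTgt p :=
  dualEdge_bijective.1 (by rw [dualEdge_sepEdge (adj_cFace_faceAt_succ p), dualEdge_cTgt])

/-- **The open arm on the left of a strand.** Along the stretch `O c [i, j]` of any orbit, the left
vertices `(O c i).1` and `(O c j).1` are joined by a lattice walk through left vertices of the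
stretch, each of whose edges is a target edge FOLLOWED by the stretch, hence open (`∈ β`). -/
theorem exists_leftWalk (β : BondConfig (Site 2)) (c : Site 2 × Fin 4) (i : ℕ) : ∀ j, i ≤ j →
    ∃ W : (zdGraph 2).Walk (cornerOrbit β c i).1 (cornerOrbit β c j).1,
      (∀ x ∈ W.support, ∃ t, i ≤ t ∧ t ≤ j ∧ x = (cornerOrbit β c t).1) ∧
      (∀ e ∈ W.edges, ∃ t, i ≤ t ∧ t < j ∧ e = cTgt (cornerOrbit β c t) ∧ cTgt (cornerOrbit β c t) ∈ β) := by
  intro j hij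
  induction j, hij using Nat.le_induction with
  | base =>
    exact ⟨SimpleGraph.Walk.nil, fun x hx => ⟨i, le_rfl, le_rfl, by simpa using hx⟩,
      fun e he => by simp at he⟩
  | succ j hij ih =>
    obtain ⟨W, hWs, hWe⟩ := ih
    by_cases hm : cTgt (cornerOrbit β c j) ∈ β
    · -- the left vertex moves along the open target edge
      have hstep : cornerOrbit β c (j + 1) =
          ((cornerOrbit β c j).1 + cornerUnit ((cornerOrbit β c j).2 + 1), (cornerOrbit β c j).2 + 3) := by
        show nextCorner β (cornerOrbit β c j) = _
        rw [nextCorner_of_mem hm]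
      have hadj : (zdGraph 2).Adj (cornerOrbit β c j).1 (cornerOrbit β c (j + 1)).1 := by
        rw [hstep]
        exact (SimpleGraph.mem_edgeSet _).1 (cTgt_mem_edgeSet (cornerOrbit β c j))
      refine ⟨W.concat hadj, fun x hx => ?_, fun e he => ?_⟩
      · rw [SimpleGraph.Walk.support_concat, List.mem_append, List.mem_singleton] at hx
        rcases hx with hx | rfl
        · obtain ⟨t, h1, h2, rfl⟩ := hWs x hx
          exact ⟨t, h1, Nat.le_succ_of_le h2, rfl⟩
        · exact ⟨j + 1, Nat.le_succ_of_le hij, le_rfl, rfl⟩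
      · rw [SimpleGraph.Walk.edges_concat, List.concat_eq_append, List.mem_append,
          List.mem_singleton] at he
        rcases he with he | rfl
        · obtain ⟨t, h1, h2, h3, h4⟩ := hWe e he
          exact ⟨t, h1, Nat.lt_succ_of_lt h2, h3, h4⟩
        · refine ⟨j, hij, Nat.lt_succ_self j, ?_, hm⟩
          rw [hstep]; rfl
    · -- the left vertex stays
      have hstep : cornerOrbit β c (j + 1) = ((cornerOrbit β c j).1, (cornerOrbit β c j).2 + 1) := by
        show nextCorner β (cornerOrbit β c j) = _
        rw [nextCorner_of_not_mem hm]
      have hv : (cornerOrbit β c (j + 1)).1 = (cornerOrbit β c j).1 := by rw [hstep]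
      refine ⟨W.copy rfl hv.symm, fun x hx => ?_, fun e he => ?_⟩
      · rw [SimpleGraph.Walk.support_copy] at hx
        obtain ⟨t, h1, h2, rfl⟩ := hWs x hx
        exact ⟨t, h1, Nat.le_succ_of_le h2, rfl⟩
      · rw [SimpleGraph.Walk.edges_copy] at he
        obtain ⟨t, h1, h2, h3, h4⟩ := hWe e he
        exact ⟨t, h1, Nat.lt_succ_of_lt h2, h3, h4⟩

/-- **The dual arm on the right of a strand.** Along the stretch `O c [i, j]` of any orbit, the
right faces `cFace (O c i)` and `cFace (O c j)` are joined by a walk of the dual lattice through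
right faces of the stretch, each of whose steps crosses (`sepEdge`) a target edge CROSSED by the
stretch, hence closed (`∉ β`). -/
theorem exists_rightWalk (β : BondConfig (Site 2)) (c : Site 2 × Fin 4) (i : ℕ) : ∀ j, i ≤ j →
    ∃ W : (zdGraph 2).Walk (cFace (cornerOrbit β c i)) (cFace (cornerOrbit β c j)),
      (∀ f ∈ W.support, ∃ t, i ≤ t ∧ t ≤ j ∧ f = cFace (cornerOrbit β c t)) ∧
      (∀ d ∈ W.darts, ∃ t, i ≤ t ∧ t < j ∧ sepEdge d.fst d.snd = cTgt (cornerOrbit β c t) ∧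
        cTgt (cornerOrbit β c t) ∉ β) := by
  intro j hij
  induction j, hij using Nat.le_induction with
  | base =>
    exact ⟨SimpleGraph.Walk.nil, fun x hx => ⟨i, le_rfl, le_rfl, by simpa using hx⟩,
      fun d hd => by simp at hd⟩
  | succ j hij ih =>
    obtain ⟨W, hWs, hWd⟩ := ih
    by_cases hm : cTgt (cornerOrbit β c j) ∈ β
    · -- the right face stays
      have hf : cFace (cornerOrbit β c (j + 1)) = cFace (cornerOrbit β c j) := by
        show cFace (nextCorner β (cornerOrbit β c j)) = _
        exact cFace_nextCorner_of_mem hm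
      refine ⟨W.copy rfl hf.symm, fun x hx => ?_, fun d hd => ?_⟩
      · rw [SimpleGraph.Walk.support_copy] at hx
        obtain ⟨t, h1, h2, rfl⟩ := hWs x hx
        exact ⟨t, h1, Nat.le_succ_of_le h2, rfl⟩
      · rw [SimpleGraph.Walk.darts_copy] at hd
        obtain ⟨t, h1, h2, h3, h4⟩ := hWd d hd
        exact ⟨t, h1, Nat.lt_succ_of_lt h2, h3, h4⟩
    · -- the right face moves across the closed target edge
      have hf : cFace (cornerOrbit β c (j + 1)) = faceAt (cornerOrbit β c j).1 ((cornerOrbit β c j).2 + 1) := by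
        show cFace (nextCorner β (cornerOrbit β c j)) = _
        exact cFace_nextCorner_of_not_mem hm
      have hadj : (zdGraph 2).Adj (cFace (cornerOrbit β c j)) (cFace (cornerOrbit β c (j + 1))) := by
        rw [hf]
        exact adj_cFace_faceAt_succ _
      refine ⟨W.concat hadj, fun x hx => ?_, fun d hd => ?_⟩
      · rw [SimpleGraph.Walk.support_concat, List.mem_append, List.mem_singleton] at hx
        rcases hx with hx | rfl
        · obtain ⟨t, h1, h2, rfl⟩ := hWs x hx
          exact ⟨t, h1, Nat.le_succ_of_le h2, rfl⟩
        · exact ⟨j + 1, Nat.le_succ_of_le hij, le_rfl, rfl⟩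
      · rw [SimpleGraph.Walk.darts_concat, List.concat_eq_append, List.mem_append,
          List.mem_singleton] at hd
        rcases hd with hd | rfl
        · obtain ⟨t, h1, h2, h3, h4⟩ := hWd d hd
          exact ⟨t, h1, Nat.lt_succ_of_lt h2, h3, h4⟩
        · refine ⟨j, hij, Nat.lt_succ_self j, ?_, hm⟩
          show sepEdge (cFace (cornerOrbit β c j)) (cFace (cornerOrbit β c (j + 1))) = _
          rw [hf]
          exact sepEdge_faceAt_succ _

/-- **The two arms of a strand** (registered sub-goal `exists_orbitArms` of stmt-CriticalPhenomena-11387;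
Smirnov's "open edges on the left, dual-open edges on the right" for an arbitrary stretch of an
arbitrary orbit, in the walk vocabulary of `zdDomArmEvent` and `Z2HalfPlane.threeArm`). -/
theorem exists_orbitArms : ∀ (β : BondConfig (Site 2)) (c : Site 2 × Fin 4) (i j : ℕ), i ≤ j → (∃ W : (zdGraph 2).Walk (cornerOrbit β c i).1 (cornerOrbit β c j).1, (∀ x ∈ W.support, ∃ t, i ≤ t ∧ t ≤ j ∧ x = (cornerOrbit β c t).1) ∧ (∀ e ∈ W.edges, ∃ t, i ≤ t ∧ t < j ∧ e = cTgt (cornerOrbit β c t) ∧ cTgt (cornerOrbit β c t) ∈ β)) ∧ (∃ W : (zdGraph 2).Walk (cFace (cornerOrbit β c i)) (cFace (cornerOrbit β c j)), (∀ f ∈ W.support, ∃ t, i ≤ t ∧ t ≤ j ∧ f = cFace (cornerOrbit β c t)) ∧ (∀ d ∈ W.darts, ∃ t, i ≤ t ∧ t < j ∧ sepEdge d.fst d.snd = cTgt (cornerOrbit β c t) ∧ cTgt (cornerOrbit β c t) ∉ β)) :=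
  fun β c i j hij => ⟨exists_leftWalk β c i j hij, exists_rightWalk β c i j hij⟩

end

end Summit.CriticalPhenomena.CardyFormulaZ2.Cruxes.EdgePrecompact.QkzStripBoundaryArm
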